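/-
Copyright: cell `pub-ymgap` (HUMAN RULING D-0062), Track A of `YM-PLAN.md`, DAG node N20 (= NE7b); R134 acceleration seat
`pub-ymgap-dag-n20-c` (strategy s1, generation 6), module 36.  Released under the licence of the surrounding project.
-/
import Summits.QuantumFields.YangMills.Theorems.BalabanUVNodesN20LCSLabelTowerAtResidualOfRecordHalves
import Summits.QuantumFields.BalabanUV.T4Continuum.Spine.NE7b.KeyPatternReading
import Summits.QuantumFields.YangMills.Theorems.BalabanUVNodesN20ByValueMultiscaleCells
import HarnessLib

/-!
# YM-DAG node N20 (= NE7b), strategy s1, module 36: PATTERN MONOTONICITY — the (α)-road's two named `Prop`s and its class weight transfer from a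
# prefix pattern to every POINTWISE-SMALLER one, hence from any pattern whose class READS a key fibre to the road's `keyPattern` (leaf-02's
# minimality `KeyPatternReading.keyPattern_subset_of_fibre_subset`); on Bałaban's label tower at the residual of record the halves therefore hold
# along EVERY sub-pattern of a pinning label pattern — the `pwA` ∕ `lcsA` SHAPE modulo one READING hypothesis; and n20-d's BY-VALUE multi-level class
# bound read there: UNCONDITIONAL modulo the regularity letters (level-dependent rates)

Track A of `YM-PLAN.md` (cell `pub-ymgap`, HUMAN RULING D-0062), node **N20** = spine estimate NE7b (`T4WeightBudget.RelWeightBound` — NOT PRINTED,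
NOT PROVED).  Seat `pub-ymgap-dag-n20-c` (R134, s1), generation 6, module 36 (after 34 ∕ 35 `…N20LCSLabelTowerAtResidualOfRecord[Halves]`).  Kernel
theorems only: 0 `def`, 0 `sorry`, standard axioms; COUNT-NEUTRAL; `--supports` the K3⁗ item.  Nothing of Bałaban's is asserted.

WHY.  The END record `Support/B16HistoryTowerExtractionStepDataLWR` asks its two one-step rows `pwA` ∕ `lcsA` = `PointwiseExtraction` ∕ `LocCondStability`
ALONG THE ROAD's KEY PATTERNS `KeyPatternReading.keyPattern T p₀ (kmemA …) K k` — the projection of the key fibre onto each step, for the planners'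
`StepReading` (which reading is of record: NC-NE7b-α, the chair's).  Modules 20–35 inhabit the two `Prop`s along LABEL PATTERNS `labelPattern E`
(families of (3.2)·(3.3)·(3.16)·(3.20) labels pinning cubes).  Leaf-02 proved the key pattern MINIMAL: `keyPattern … j g ⊆ branch j g ∩ S j g` for
every prefix pattern `S` whose class reads the fibre (`keyPattern_subset_of_fibre_subset`).  THIS FILE supplies the missing monotonicity sentence —
both `Prop`s and the class weight DESCEND to pointwise-smaller patterns (non-negative step kernels) — so that whatever reading the planners fix, the
instance owes along `keyPattern` exactly what it has along a label pattern reading the fibre, plus that ONE combinatorial reading hypothesis.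

WHAT.
* §1 (one tower `T`, patterns `S′ ≤ S` pointwise): `pointwiseExtraction_mono` (step kernels `≥ 0` on the branches), `locCondStability_mono`,
  `sum_admS_integral_mono` (class weights of non-negative terms grow with the pattern; `PrefixExtraction.admS_mono`).
* §2 (the road's cutoff family `T : ℕ → Tower P (C K) (𝒢 K)`, any key map `kmem` on `skelFam T p₀`): ★ `pointwiseExtraction_keyPattern_of_fibre_subset`,
  ★ `locCondStability_keyPattern_of_fibre_subset`, `sum_admS_keyPattern_le_of_fibre_subset` — the halves ∕ class weight along `S K x` and the reading
  `fibre kmem (termSet (skelFam T p₀)) K k ⊆ badx T p₀ S K x` give them along `keyPattern T p₀ kmem K k`.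
* §3 (Bałaban's label tower at the residual of record, module 35): ★★ **`halves_rec_rootedAtZero_of_subpattern`** — `PointwiseExtraction ∧ LocCondStability`
  for keys rooted at step 0 along EVERY pattern `S′` pointwise inside a label pattern `labelPattern E` pinning `D` at level `0` (same carriers ∕ exponents,
  same residual letter `hreg`); `sum_admS_integral_le_rec_rootedAtZero_of_subpattern` (the class bound likewise).
* §4 ★★★ **`sum_admS_integral_le_rec_allLevels_byValue`** — n20-d g7's BY-VALUE multi-level class bound (`N20ByValueMultiscaleCells`, one factor
  `m_j·e^{v_{j+1}}·e^{−τ_{j+1}g₀⁻²ε_j²∕(2N)}` per pinned cube per pinned level, LEVEL-DEPENDENT letters `τ`, `v`) read at the residual of record with the two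
  laws and (O4) supplied: UNCONDITIONAL modulo `hreg` — side by side with module 35 §3 (by name, level-uniform, modulo «LCS-j» at `j ≥ 1`).
* §5 SANITY `sum_admS_integral_le_rec_rootedAtZero_of_epsreg_le` — in the degenerate threshold regime (`εreg ≤ ε_1`, module 24's `hreg_of_epsreg_le`) the
  class bound for keys rooted at step 0 holds with NO displayed hypothesis at all (every analytic binder of the lineage a theorem): joint inhabitation.

HONEST FRAMING.  Finite bookkeeping ([folklore]); the reading hypothesis (`fibre ⊆ badx`, resp. `S′ ≤ labelPattern E`) is DISPLAYED, not discharged —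
it is the planners' key-pattern READING; nothing of Bałaban's is asserted; «LCS-j» (j ≥ 1) untouched (THE wall); NE7b NOT PRINTED ∕ NOT PROVED;
(α)-instance 0∕1; N20 NOT discharged; typed 28∕28, discharged count untouched; one finite four-torus at fixed `ε` — NOT ℝ⁴, NOT infinite volume, NOT OS,
NOT a mass gap, NOT Clay.

References (LOCATORS): T. Bałaban, CMP 119 (1988) 243–285 [Balaban1988Convergent] ((3.2)–(3.5) p. 265); CMP 122 (1989) 355–392 [Balaban1989LargeFieldII]
((1.79)–(1.80) pp. 383–384: «summations over the admissible sequences»).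
-/

set_option autoImplicit false

noncomputable section

open scoped BigOperators

namespace Summit.QuantumFields.YangMills.BalabanUVNodes.N20LCSPatternMonotone

open MeasureTheory
open Literature.MathematicalPhysics.QuantumFieldTheory.Balaban1983to89
open Literature.MathematicalPhysics.QuantumFieldTheory.Balaban1983to89.T4Continuum
open Literature.MathematicalPhysics.QuantumFieldTheory.Balaban1983to89.T4LiveClassFibration (fibre)
open Literature.MathematicalPhysics.QuantumFieldTheory.Balaban1983to89.Node00
open Summit.QuantumFields.BalabanUV.T4Continuum.B16HistoryIndexedRepr
open Summit.QuantumFields.BalabanUV.T4Continuum.B16HistoryReprChain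
open Summit.QuantumFields.BalabanUV.T4Continuum.B16HistoryReprInstance (skelFam)
open Summit.QuantumFields.BalabanUV.T4Continuum.NE7b.PrefixExtraction (admS admS_mono admS_subset_adm)
open Summit.QuantumFields.BalabanUV.T4Continuum.NE7b.PrefixExtractionLaws (badx)
open Summit.QuantumFields.BalabanUV.T4Continuum.NE7b.LocalConditionalStability (LocCondStability PointwiseExtraction)
open Summit.QuantumFields.BalabanUV.T4Continuum.NE7b.KeyPatternReading (keyPattern keyPattern_subset_of_fibre_subset)
open Summit.QuantumFields.YangMills.BalabanUVNodes.N20LCSLabelTower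
open Summit.QuantumFields.YangMills.BalabanUVNodes.N20LCSLabelTowerAtResidualOfRecord (measurable_ωOfRecord_rec)
open Summit.QuantumFields.YangMills.BalabanUVNodes.N20LCSLabelTowerAtResidualOfRecordHalves
open Summit.QuantumFields.YangMills.BalabanUVNodes.N20ByValueMultiscaleCells (sum_admS_integral_le_labelTower_allLevels_byValue)

/-! ## §1 One tower: both halves and the class weight descend to pointwise-smaller patterns -/

section Mono

variable {P : Type} [DecidableEq P] {C : ℕ → Type} {𝒢 : (j : ℕ) → GoodClass (C j)} {T : Tower P C 𝒢}
  {S S' : (j : ℕ) → (Fin j → P) → Finset P} {K : ℕ}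

/-- **POINTWISE EXTRACTION DESCENDS TO SMALLER PATTERNS**: if the step kernels are non-negative on the branches and `S′ j g ⊆ S j g` after every
prefix, `PointwiseExtraction T S K χ M a → PointwiseExtraction T S′ K χ M a` (fewer pinned choices sum to less; every `S′`-prefix is an `S`-prefix,
`admS_mono`). [folklore] -/
theorem pointwiseExtraction_mono {χ : (j : ℕ) → (Fin j → P) → P → C j → ℝ} {M : (j : ℕ) → (Fin j → P) → C j → ℝ}
    {a : (j : ℕ) → (Fin j → P) → ℝ} (hχ : ∀ j g, ∀ p ∈ T.branch j g, ∀ y, 0 ≤ χ j g p y) (hS : ∀ j g, S' j g ⊆ S j g)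
    (h : PointwiseExtraction T S K χ M a) : PointwiseExtraction T S' K χ M a := by
  intro j g hj hg y
  refine le_trans ?_ (h j g hj (admS_mono hS j hg) y)
  exact Finset.sum_le_sum_of_subset_of_nonneg (Finset.inter_subset_inter (Finset.Subset.refl _) (hS j g))
    fun p hp _ => hχ j g p (Finset.mem_inter.1 hp).1 y

/-- **LOCAL CONDITIONAL STABILITY DESCENDS TO SMALLER PATTERNS**: `S′ ≤ S` pointwise gives
`LocCondStability T S K μ ρ₀ M b → LocCondStability T S′ K μ ρ₀ M b` (the moment bound is asked at fewer prefixes). [folklore] -/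
theorem locCondStability_mono [∀ j, MeasurableSpace (C j)] {μ : (j : ℕ) → Measure (C j)} {ρ₀ : C 0 → ℝ}
    {M : (j : ℕ) → (Fin j → P) → C j → ℝ} {b : (j : ℕ) → (Fin j → P) → ℝ} (hS : ∀ j g, S' j g ⊆ S j g)
    (h : LocCondStability T S K μ ρ₀ M b) : LocCondStability T S' K μ ρ₀ M b :=
  fun j g hj hg => h j g hj (admS_mono hS j hg)

/-- **THE CLASS WEIGHT GROWS WITH THE PATTERN**: for a good non-negative `ρ₀` and `S′ ≤ S` pointwise,
`Σ_{h ∈ admS T S′ K} ∫ eterm ρ₀ K h dμ ≤ Σ_{h ∈ admS T S K} ∫ eterm ρ₀ K h dμ`. [folklore] -/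
theorem sum_admS_integral_mono [MeasurableSpace (C K)] (μ : Measure (C K)) {ρ₀ : C 0 → ℝ} (hρ : (𝒢 0).Gd ρ₀) (h0 : ∀ x, 0 ≤ ρ₀ x)
    (hS : ∀ j g, S' j g ⊆ S j g) :
    ∑ h ∈ admS T S' K, ∫ x, T.eterm ρ₀ K h x ∂μ ≤ ∑ h ∈ admS T S K, ∫ x, T.eterm ρ₀ K h x ∂μ :=
  Finset.sum_le_sum_of_subset_of_nonneg (admS_mono hS K) fun h _ _ => integral_nonneg fun x => T.eterm_nonneg hρ h0 K h x

end Mono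

/-! ## §2 The road's key patterns: halves ∕ class weight along any pattern reading the fibre give them along `keyPattern` -/

section KeyPatterns

variable {P : Type} [DecidableEq P] {C : ℕ → ℕ → Type} {𝒢 : (K j : ℕ) → GoodClass (C K j)}
  (T : (K : ℕ) → Tower P (C K) (𝒢 K)) (p₀ : ℕ → ℕ → P) {ω : Type*} [DecidableEq ω]
  (kmem : ℕ → HIndex.Idx (skelFam T p₀) → ω) {α : Type*} (S : (K : ℕ) → α → (j : ℕ) → (Fin j → P) → Finset P)

/-- ★ **`pwA`'s SHAPE FROM A READING PATTERN**: if the class of `S K x` reads the fibre of the key `k` (`fibre ⊆ badx`) and the step kernels are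
non-negative on the branches, pointwise extraction along `S K x` gives pointwise extraction along the road's `keyPattern T p₀ kmem K k` — same kernels,
carriers, exponents (leaf-02's minimality + §1). [folklore] -/
theorem pointwiseExtraction_keyPattern_of_fibre_subset {K K' : ℕ} {k : ω} {x : α}
    (hread : fibre kmem (HIndex.termSet (skelFam T p₀)) K k ⊆ badx T p₀ S K x)
    {χ : (j : ℕ) → (Fin j → P) → P → C K j → ℝ} {M : (j : ℕ) → (Fin j → P) → C K j → ℝ} {a : (j : ℕ) → (Fin j → P) → ℝ}
    (hχ : ∀ j g, ∀ p ∈ (T K).branch j g, ∀ y, 0 ≤ χ j g p y) (h : PointwiseExtraction (T K) (S K x) K' χ M a) :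
    PointwiseExtraction (T K) (keyPattern T p₀ kmem K k) K' χ M a :=
  pointwiseExtraction_mono hχ (fun j g => (keyPattern_subset_of_fibre_subset T p₀ kmem S hread j g).trans Finset.inter_subset_right) h

/-- ★ **`lcsA`'s SHAPE FROM A READING PATTERN**: the same transfer for local conditional stability. [folklore] -/
theorem locCondStability_keyPattern_of_fibre_subset {K K' : ℕ} {k : ω} {x : α}
    (hread : fibre kmem (HIndex.termSet (skelFam T p₀)) K k ⊆ badx T p₀ S K x)
    [∀ j, MeasurableSpace (C K j)] {μ : (j : ℕ) → Measure (C K j)} {ρ₀ : C K 0 → ℝ}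
    {M : (j : ℕ) → (Fin j → P) → C K j → ℝ} {b : (j : ℕ) → (Fin j → P) → ℝ} (h : LocCondStability (T K) (S K x) K' μ ρ₀ M b) :
    LocCondStability (T K) (keyPattern T p₀ kmem K k) K' μ ρ₀ M b :=
  locCondStability_mono (fun j g => (keyPattern_subset_of_fibre_subset T p₀ kmem S hread j g).trans Finset.inter_subset_right) h

/-- **THE KEY PATTERN's CLASS WEIGHS AT MOST THE READING PATTERN's**. [folklore] -/
theorem sum_admS_keyPattern_le_of_fibre_subset {K K' : ℕ} {k : ω} {x : α}
    (hread : fibre kmem (HIndex.termSet (skelFam T p₀)) K k ⊆ badx T p₀ S K x)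
    [MeasurableSpace (C K K')] (μ : Measure (C K K')) {ρ₀ : C K 0 → ℝ} (hρ : (𝒢 K 0).Gd ρ₀) (h0 : ∀ y, 0 ≤ ρ₀ y) :
    ∑ h ∈ admS (T K) (keyPattern T p₀ kmem K k) K', ∫ y, (T K).eterm ρ₀ K' h y ∂μ ≤
      ∑ h ∈ admS (T K) (S K x) K', ∫ y, (T K).eterm ρ₀ K' h y ∂μ :=
  sum_admS_integral_mono μ hρ h0 fun j g => (keyPattern_subset_of_fibre_subset T p₀ kmem S hread j g).trans Finset.inter_subset_right

end KeyPatterns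

/-! ## §3 Bałaban's label tower at the residual of record: the halves along every sub-pattern of a pinning label pattern -/

section Record

variable (F : T4Family) (N : ℕ) [NeZero N] (ν : Stage7Numerics) (M : ℕ) (p : B12.RunParams) (g : ℕ → ℝ)

open Classical in
/-- ★★ **THE HALVES FOR KEYS ROOTED AT STEP 0 ALONG EVERY SUB-PATTERN OF A PINNING LABEL PATTERN** (module 35's `halves_rec_rootedAtZero` + §1; the label
tower's step kernels `labelChi ≥ 0`): with module 35's data and residual letter `hreg`, for every prefix pattern `S′` with `S′ j h ⊆ labelPattern E j h`
after every prefix — e.g. the road's `keyPattern` of a key whose fibre the class of `labelPattern E` reads — BOTH NAMED `Prop`s hold along `S′` with the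
same carriers and exponents. [folklore] -/
theorem halves_rec_rootedAtZero_of_subpattern :
    ∃ δ₀ : ℝ, 0 < δ₀ ∧ ∃ C : ℝ, 0 ≤ C ∧ ∀ (_hK : 1 ≤ p.K) (g₀ E₀ : ℝ), 4 * N ≤ g₀⁻¹ ^ 2 → ∀ (A₁ : ℝ)
      (D : Finset (Iχ F ν p g 0)) (R : Iχ F ν p g 0 → Finset (Plaq (F.P p.K) 1)) (m : ℕ) (ε'' : ℝ), 0 ≤ ε'' →
        (∀ c ∈ D, (R c).card ≤ m) → (∀ c₁ ∈ D, ∀ c₂ ∈ D, c₁ ≠ c₂ → Disjoint (R c₁) (R c₂)) →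
        (∀ c ∈ D, ∀ V' : GaugeField (F.P p.K) 1 (SU N),
          (∀ p' ∈ R c, dist1 (GaugeField.plaqHol V' p') < ε'') → chiFactor F N ν p g 0 c V' = 1) →
      ∀ (Kc : ℕ) (E : (j : ℕ) → (Fin j → LabelPat F ν p g) → Finset (LbOfRecord F ν p g j))
        (S' : (j : ℕ) → (Fin j → LabelPat F ν p g) → Finset (LabelPat F ν p g))
        (Mc : (j : ℕ) → (Fin j → LabelPat F ν p g) → cfgOfRecord F N p.K j → ℝ) (a b : (j : ℕ) → (Fin j → LabelPat F ν p g) → ℝ),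
        (∀ h t, t ∈ E 0 h → D ⊆ t.1) → (∀ j h, S' j h ⊆ labelPattern F ν p g E j h) →
        (∀ (h : Fin 0 → LabelPat F ν p g) (U : cfgOfRecord F N p.K 0), Mc 0 h U = Real.exp (a 0 h) *
          Set.indicator {U : GaugeField (F.P p.K) 0 (SU N) |
            ∀ c ∈ D, ∃ p' ∈ R c, ε'' ≤ dist1 (GaugeField.plaqHol ((avOfRecord F N p.K 0).avg U) p')} (fun _ => (1 : ℝ)) U) →
        (∀ (j : ℕ) (h : Fin j → LabelPat F ν p g), 1 ≤ j → Mc j h = fun _ => 1) →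
        (∀ h : Fin 0 → LabelPat F ν p g, Real.exp (a 0 h) *
          ((m : ℝ) * Real.exp (C * δ₀ - δ₀ * g₀⁻¹ ^ 2 * (ε'' ^ 2 / (2 * (Fintype.card (Fin N) : ℝ))))) ^ D.card ≤
            Real.exp (b 0 h)) →
        (∀ (j : ℕ) (h : Fin j → LabelPat F ν p g), 1 ≤ j → a j h ≤ 0 ∧ 0 ≤ b j h) →
        PointwiseExtraction (labelTowerOfRecord F N ν M p g A₁ (zeta316OfRecord F N ν M A₁)) S' Kc
            (labelChi F N ν M p g A₁ (zeta316OfRecord F N ν M A₁)) Mc a ∧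
          LocCondStability (labelTowerOfRecord F N ν M p g A₁ (zeta316OfRecord F N ν M A₁)) S' Kc
            (lawOfRecord F N p.K) (rhoZeroOfRecord F N p.K g₀ E₀) Mc b := by
  obtain ⟨δ₀, hδ₀, C, hC, h35⟩ := halves_rec_rootedAtZero F N ν M p g
  refine ⟨δ₀, hδ₀, C, hC, ?_⟩
  intro hK g₀ E₀ hg A₁' D R m ε'' hε hm hdisj hreg Kc E S' Mc a b hE0 hS' hM0 hMj hb0 habj
  obtain ⟨hPE, hLCS⟩ := h35 hK g₀ E₀ hg A₁' D R m ε'' hε hm hdisj hreg Kc E Mc a b hE0 hM0 hMj hb0 habj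
  exact ⟨pointwiseExtraction_mono (fun j h q _ U => labelChi_nonneg F N ν M p g j h q U) hS' hPE, locCondStability_mono hS' hLCS⟩

open Classical in
/-- **THE CLASS BOUND FOR KEYS ROOTED AT STEP 0 ALONG EVERY SUB-PATTERN OF A PINNING LABEL PATTERN** (module 35's
`sum_admS_integral_le_rec_rootedAtZero` + §1): one Peierls factor per pinned cube, for the class of any `S′ ≤ labelPattern E`. [folklore] -/
theorem sum_admS_integral_le_rec_rootedAtZero_of_subpattern :
    ∃ δ₀ : ℝ, 0 < δ₀ ∧ ∃ C : ℝ, 0 ≤ C ∧ ∀ (_hK : 1 ≤ p.K) (g₀ E₀ : ℝ), 4 * N ≤ g₀⁻¹ ^ 2 → ∀ (A₁ : ℝ)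
      (D : Finset (Iχ F ν p g 0)) (R : Iχ F ν p g 0 → Finset (Plaq (F.P p.K) 1)) (m : ℕ) (ε'' : ℝ), 0 ≤ ε'' → 1 ≤ m →
        (∀ c ∈ D, (R c).card ≤ m) → (∀ c₁ ∈ D, ∀ c₂ ∈ D, c₁ ≠ c₂ → Disjoint (R c₁) (R c₂)) →
        (∀ c ∈ D, ∀ V' : GaugeField (F.P p.K) 1 (SU N),
          (∀ p' ∈ R c, dist1 (GaugeField.plaqHol V' p') < ε'') → chiFactor F N ν p g 0 c V' = 1) →
      ∀ (Kc : ℕ) (E : (j : ℕ) → (Fin j → LabelPat F ν p g) → Finset (LbOfRecord F ν p g j))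
        (S' : (j : ℕ) → (Fin j → LabelPat F ν p g) → Finset (LabelPat F ν p g)),
        (∀ h t, t ∈ E 0 h → D ⊆ t.1) → (∀ j h, S' j h ⊆ labelPattern F ν p g E j h) →
        ∑ h ∈ admS (labelTowerOfRecord F N ν M p g A₁ (zeta316OfRecord F N ν M A₁)) S' (Kc + 1),
            ∫ x, (labelTowerOfRecord F N ν M p g A₁ (zeta316OfRecord F N ν M A₁)).eterm (rhoZeroOfRecord F N p.K g₀ E₀) (Kc + 1) h x
              ∂(lawOfRecord F N p.K (Kc + 1)) ≤
          ((m : ℝ) * Real.exp (C * δ₀ - δ₀ * g₀⁻¹ ^ 2 * (ε'' ^ 2 / (2 * (Fintype.card (Fin N) : ℝ))))) ^ D.card *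
            ∫ x, rhoZeroOfRecord F N p.K g₀ E₀ x ∂(fieldMeasure (F.P p.K) 0 (SU N)) := by
  obtain ⟨δ₀, hδ₀, C, hC, h35⟩ := sum_admS_integral_le_rec_rootedAtZero F N ν M p g
  refine ⟨δ₀, hδ₀, C, hC, ?_⟩
  intro hK g₀ E₀ hg A₁' D R m ε'' hε hm1 hm hdisj hreg Kc E S' hE0 hS'
  exact (sum_admS_integral_mono (T := labelTowerOfRecord F N ν M p g A₁' (zeta316OfRecord F N ν M A₁')) (lawOfRecord F N p.K (Kc + 1))
    (rhoZeroOfRecord_good F N p.K g₀ E₀) (fun U => (rhoZeroOfRecord_pos F N p.K g₀ E₀ U).le) hS').trans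
    (h35 hK g₀ E₀ hg A₁' D R m ε'' hε hm1 hm hdisj hreg Kc E hE0)

/-! ## §4 n20-d's by-value multi-level class bound at the residual of record: UNCONDITIONAL modulo the regularity letters (level-dependent rates) -/

open Classical in
/-- ★★★ **THE MULTI-LEVEL CLASS WEIGHT BOUND BY VALUE ON BAŁABAN's LABEL TOWER AT THE RESIDUAL OF RECORD — NO LAW, NO MEASURABILITY LETTER, NO «LCS-j»**
(n20-d g7's `N20ByValueMultiscaleCells.sum_admS_integral_le_labelTower_allLevels_byValue` with K0b's two laws and module 34's (O4) row supplied): there are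
LEVEL-DEPENDENT rates `τ k > 0` and volumes `v k ≥ 0` (letters of `N`, `L`, the level) such that, for `g₀⁻² ≥ 4N`, every `E₀`, `A₁`, every finite set `J`
of pinned levels `j < K`, cube families `D j` with regularity letters on pairwise disjoint regions `R j □` (`#≤ m j`) at thresholds `ε j ≥ 0`, every cutoff
`K′` and every label pattern pinning `D j` at `j ∈ J` and FREE elsewhere:
`Σ_{h ∈ admS … (labelPattern E) K′} ∫ eterm ρ₀ K′ h dμ_{K′} ≤ Π_{j ∈ J, j < K′} (m_j·e^{v_{j+1}}·e^{−τ_{j+1} g₀⁻² ε_j²∕(2N)})^{#D j} · ∫ ρ₀ dU₀`.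
Side by side with module 35 §3: by VALUE the bound is unconditional with level-dependent rates (this theorem); by NAME it is level-uniform modulo «LCS-j»
at the pinned levels `j ≥ 1` (THE wall).  The only displayed analytic input here is `hreg`. [folklore] -/
theorem sum_admS_integral_le_rec_allLevels_byValue (A₁ : ℝ) :
    ∃ τ : ℕ → ℝ, (∀ k, 0 < τ k) ∧ ∃ v : ℕ → ℝ, (∀ k, 0 ≤ v k) ∧ ∀ (g₀ E₀ : ℝ), 4 * N ≤ g₀⁻¹ ^ 2 →
      ∀ (J : Finset ℕ), (∀ j ∈ J, j < p.K) →
      ∀ (D : (j : ℕ) → Finset (Iχ F ν p g j)) (R : (j : ℕ) → Iχ F ν p g j → Finset (Plaq (F.P p.K) (j + 1))) (m : ℕ → ℕ) (ε : ℕ → ℝ),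
        (∀ j ∈ J, 0 ≤ ε j) → (∀ j ∈ J, ∀ c ∈ D j, (R j c).card ≤ m j) →
        (∀ j ∈ J, ∀ c₁ ∈ D j, ∀ c₂ ∈ D j, c₁ ≠ c₂ → Disjoint (R j c₁) (R j c₂)) →
        (∀ j ∈ J, ∀ c ∈ D j, ∀ V' : GaugeField (F.P p.K) (j + 1) (SU N),
          (∀ p' ∈ R j c, dist1 (GaugeField.plaqHol V' p') < ε j) → chiFactor F N ν p g j c V' = 1) →
      ∀ (K' : ℕ) (E : (j : ℕ) → (Fin j → LabelPat F ν p g) → Finset (LbOfRecord F ν p g j)),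
        (∀ j ∈ J, ∀ h t, t ∈ E j h → D j ⊆ t.1) → (∀ j, j ∉ J → ∀ h, E j h = Finset.univ) →
        ∑ h ∈ admS (labelTowerOfRecord F N ν M p g A₁ (zeta316OfRecord F N ν M A₁)) (labelPattern F ν p g E) K',
            ∫ x, (labelTowerOfRecord F N ν M p g A₁ (zeta316OfRecord F N ν M A₁)).eterm (rhoZeroOfRecord F N p.K g₀ E₀) K' h x
              ∂(lawOfRecord F N p.K K') ≤
          (∏ j ∈ J.filter (· < K'), ((m j : ℝ) * (Real.exp (v (j + 1)) *
              Real.exp (-(τ (j + 1) * g₀⁻¹ ^ 2 * (ε j ^ 2 / (2 * (Fintype.card (Fin N) : ℝ))))))) ^ (D j).card) *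
            ∫ U, rhoZeroOfRecord F N p.K g₀ E₀ U ∂(fieldMeasure (F.P p.K) 0 (SU N)) := by
  obtain ⟨τ, hτ, v, hv, h12⟩ := sum_admS_integral_le_labelTower_allLevels_byValue F N ν M p g
  refine ⟨τ, hτ, v, hv, ?_⟩
  intro g₀ E₀ hg J hJ D R m ε hε hm hdisj hreg K' E hE hfree
  exact h12 g₀ E₀ A₁ hg (isZetaUnity_zeta316OfRecord A₁) (isZetaAbsLeOne_zeta316OfRecord A₁) (measurable_ωOfRecord_rec F N ν M p g A₁) J hJ D R m ε
    hε hm hdisj hreg K' E hE hfree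

/-! ## §5 Sanity: in the degenerate threshold regime the chain fires with EVERY binder discharged -/

open Summit.QuantumFields.YangMills.BalabanUVNodes.N20LCSLargeFieldRootedAtZero (hreg_of_epsreg_le) in
open Classical in
/-- **SANITY (A3 witness, NOT Bałaban's regime): THE CLASS BOUND FOR KEYS ROOTED AT STEP 0 WITH NO DISPLAYED HYPOTHESIS AT ALL.**  When the
level-`1` test threshold dominates the regularity threshold (`εreg ≤ ε_1`, `0 < ε_1·η_1²`) the regularity letter `hreg` is module 24's theorem
`hreg_of_epsreg_le`, so module 35's `sum_admS_integral_le_rec_rootedAtZero` holds with only numeric ∕ combinatorial side conditions left — every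
analytic binder of the lineage (ζ-laws, (O4), `hreg`, tower rows) is a theorem here: the currency is jointly inhabited on the object of record.
(In Bałaban's regime `ε_1 < εreg` and `hreg` is [Balaban1985Variational] Thm 1.) [folklore] -/
theorem sum_admS_integral_le_rec_rootedAtZero_of_epsreg_le :
    ∃ δ₀ : ℝ, 0 < δ₀ ∧ ∃ C : ℝ, 0 ≤ C ∧ ∀ (_hK : 1 ≤ p.K) (g₀ E₀ : ℝ), 4 * N ≤ g₀⁻¹ ^ 2 →
      ν.εreg ≤ epsOfRecord ν g 1 → 0 < epsOfRecord ν g 1 * (F.P p.K).eta 1 ^ 2 → ∀ (A₁ : ℝ)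
      (D : Finset (Iχ F ν p g 0)) (R : Iχ F ν p g 0 → Finset (Plaq (F.P p.K) 1)) (m : ℕ) (ε'' : ℝ), 0 ≤ ε'' → 1 ≤ m →
        (∀ c ∈ D, (R c).card ≤ m) → (∀ c₁ ∈ D, ∀ c₂ ∈ D, c₁ ≠ c₂ → Disjoint (R c₁) (R c₂)) →
      ∀ (Kc : ℕ) (E : (j : ℕ) → (Fin j → LabelPat F ν p g) → Finset (LbOfRecord F ν p g j)), (∀ h t, t ∈ E 0 h → D ⊆ t.1) →
        ∑ h ∈ admS (labelTowerOfRecord F N ν M p g A₁ (zeta316OfRecord F N ν M A₁)) (labelPattern F ν p g E) (Kc + 1),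
            ∫ x, (labelTowerOfRecord F N ν M p g A₁ (zeta316OfRecord F N ν M A₁)).eterm (rhoZeroOfRecord F N p.K g₀ E₀) (Kc + 1) h x
              ∂(lawOfRecord F N p.K (Kc + 1)) ≤
          ((m : ℝ) * Real.exp (C * δ₀ - δ₀ * g₀⁻¹ ^ 2 * (ε'' ^ 2 / (2 * (Fintype.card (Fin N) : ℝ))))) ^ D.card *
            ∫ x, rhoZeroOfRecord F N p.K g₀ E₀ x ∂(fieldMeasure (F.P p.K) 0 (SU N)) := by
  obtain ⟨δ₀, hδ₀, C, hC, h35⟩ := sum_admS_integral_le_rec_rootedAtZero F N ν M p g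
  refine ⟨δ₀, hδ₀, C, hC, ?_⟩
  intro hK g₀ E₀ hg hle hη A₁' D R m ε'' hε hm1 hm hdisj Kc E hE0
  exact h35 hK g₀ E₀ hg A₁' D R m ε'' hε hm1 hm hdisj (fun c _ => hreg_of_epsreg_le F N ν p g 0 c hle hη (R c) ε'') Kc E hE0

end Record

end Summit.QuantumFields.YangMills.BalabanUVNodes.N20LCSPatternMonotone

end
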